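import Mathlib.Analysis.Complex.ExponentialBounds
import Summits.QuantumFields.BalabanUV.Beta.EriceRemainderEnclosureHistoryAutonomyComparisonAffineProfile
import Summits.QuantumFields.BalabanUV.Beta.EriceRemainderEnclosureHistoryAutonomyComparisonKernelEnergy

/-!
# EriceRemainderEnclosureHistoryAutonomyComparisonWindowHundred — (E58b-W) ALL MEMORY AGES WITHIN A FACTOR 100 COMPARE AT ANY SIZE: every profile
# `L ≥ 0` whose ages `k ≥ 1` lie in a window `[K₀, R·K₀]` has **`Σ_j L_j∕P_j ≤ 1∕(ρ·(1 − log R∕16))`** (`ρ = 1∕√2`; ANY number of ages, ANY sizes, the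
# Markov weight `L_0` arbitrary) — `≤ 2`, (E58b)'s profile condition, as soon as **`log R ≤ 8(2 − √2) ≈ 4.686`, `R ≤ 108.4`**; in particular for the
# factor `100` ((E58c): `3`; (E63e): `7`; (P3·T1b): three ages within `36`), by the symmetric-kernel energy method of `…ComparisonKernelEnergy`

Cell `pub-balaban`, β-function sub-cell, BINDER row D4 «RemainderConst leaves for Bałaban's split» (`HOME/BINDER-OWNERS.md`; owner lineage `b2b-balaban-beta-an4`;
this file by co-owner #3 lineage `b2b-balaban-beta-d4-p3`, generation 101, road P3), β-FLOW TEAM duty (1), FREEZE (0) honoured (def-free; (E58b)'s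
`le_of_isotone_excess_affine_profile`, `…ComparisonKernelEnergy`'s `sum_div_le_inv_of_affine_minorant` ∕ `sqrt_half_mul_le_geomRead`, Mathlib's
`Real.log_two_lt_d9` ∕ `Real.one_sub_inv_le_log_of_pos` BY NAME; nothing restated).  Answer, up to the factor `≈ 108`, to the WINDOW CONJECTURE (E58b-W) of
`HOME/b2b-balaban-beta-d4-p3/g100/WINDOW-FRONTIER.md` («every profile on a window of ratio `R` passes the profile condition iff `R ≤ 133.9`»).

HONEST FRAMING (page 1, verbatim and binding).  *"Discharging BetaPertH makes Bałaban's UV stability UNCONDITIONAL — a real constructive-QFT result; it is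
NOT the continuum limit and NOT the Clay problem."*  THIS FILE DISCHARGES NOTHING OF THE KIND.  Elementary real analysis about ABSTRACT affine functionals on
a box ]0,γ]^ℕ — hypotheses of a census, not facts; the age profile of Bałaban's (1.22) limit functional is NOT PRINTED ([I] p. 298; GAPS G-t4-U2-1∕-2) and NOT
asserted.  Row D4 class UNCHANGED (critical-path width 0; instance 0∕1; D4 DISCHARGE NO DATE).  HONEST DEPENDENCY: continuum YM on T⁴ ⇐ BetaPertH ∧ nine
spine estimates (0/9 proved); BetaPertH ⇐ (D1) ∧ (D4) ∧ CAP+tail; G-an2-4 gates asym, D1 and NE2/3/4.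

THE POINT (census sense (α); the COMPARISON column, conjecture (E58′)).  (E58b): `Σ_{j<K} L_j∕P_j ≤ 2`, `P_j = Σ_{k<K} L_k·√(j∕(j+k))`, suffices for comparison
at any size.  `…ComparisonKernelEnergy` bounds the profile sum of ANY profile by the reciprocal of a copositivity constant of the GEOMETRIC reads
`σ_jk = √(s_jk s_kj) = (jk)^{1∕4}∕√(j+k)` on the support, and supplies such a constant from any affine minorant in a line coordinate.  §1 instantiates: index set
`range K`, kernel `s_jk = √(j∕(j+k))`, coordinate `w_j = log j`; a positive load forces `j ≥ 1` and `L_j ≠ 0` (`ne_zero_of_load_pos`), so the support sits in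
`[log K₀, log K₀ + log R]` (half-length `h = log R∕2`), and the minorant `σ_jk ≥ ρ(1 − |log j − log k|∕8)` (`sqrt_half_mul_le_geomRead`) has `ρ′ = ρ`,
`λ = ρ∕8`; hence **`Σ_j L_j∕P_j ≤ 1∕(ρ − λh) = 1∕(ρ(1 − log R∕16))`** (`profileSum_le_inv_of_logWindow`) — `1.61 ∕ 1.82 ∕ 1.99` at `R = 7 ∕ 36 ∕ 100` against the
true suprema `2∕(ρ + R^{1∕4}∕√(1+R)) = 1.56 ∕ 1.80 ∕ 1.96` (two ages at ratio `R`, weights `1 : R^{1∕4}`; gen 100's memo F1).  Since `2ρ² = 1`, the bound is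
`≤ 2` iff `log R ≤ 16(1 − ρ) = 8(2 − √2)` (`profileSum_le_two_of_logWindow`); `log 100 = 7·log 2 − log(32∕25) ≤ 4.6333 ≤ 8(2 − √2)` (`log_hundred_le`) gives
the factor `100` (`profileSum_le_two_of_window_hundred`).  §2: the comparison theorems via (E58b) BY NAME (`le_of_isotone_excess_affine_logWindow`,
`le_of_isotone_excess_affine_window_hundred`).  NOT CLAIMED: the conjectured sharp factor `133.9` (affine minorants stop at `≈ 126`; see the census in
`…ComparisonKernelEnergy`'s header); anything printed.

WHAT IS PROVED ([folklore]; 0 `def`, 0 sorry).  §1 `ne_zero_of_load_pos`, **`profileSum_le_inv_of_logWindow`**, `log_hundred_le`, **`profileSum_le_two_of_logWindow`**,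
**`profileSum_le_two_of_window_hundred`**.  §2 **`le_of_isotone_excess_affine_logWindow`**, **`le_of_isotone_excess_affine_window_hundred`**.
-/
noncomputable section
open Finset Set

namespace Summit.QuantumFields.BalabanUV.Beta.EriceRemainderEnclosureHistoryAutonomyComparisonWindowHundred

open Literature.MathematicalPhysics.QuantumFieldTheory.Balaban1983to89
open Literature.MathematicalPhysics.QuantumFieldTheory.Balaban1983to89.T4BetaStationary
open Literature.MathematicalPhysics.QuantumFieldTheory.Balaban1983to89.T4BetaFlowWellPosed
open Summit.QuantumFields.BalabanUV.Beta.EriceRemainderEnclosureHistoryAutonomyComparisonAffineProfile (le_of_isotone_excess_affine_profile)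
open Summit.QuantumFields.BalabanUV.Beta.EriceRemainderEnclosureHistoryAutonomyComparisonKernelEnergy
  (sum_div_le_inv_of_affine_minorant sqrt_half_mul_le_geomRead)

variable {B' : (ℕ → ℝ) → ℝ} {M' γ b : ℝ} {L : ℕ → ℝ} {K : ℕ} {h h' : ℕ → ℝ}

/-! ## §1 The profile sum of a window of ratio `R`: `Σ_j L_j∕P_j ≤ 1∕(ρ(1 − log R∕16))`; `≤ 2` for `log R ≤ 8(2 − √2)`, in particular for the factor `100` -/

/-- A positive load `L_j∕P_j > 0` forces `j ≠ 0` (the Markov index has `P_0 = Σ_k L_k·√(0∕k) = 0`, and Lean's `x∕0 = 0`) and `L_j ≠ 0`. [folklore] -/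
theorem ne_zero_of_load_pos {j : ℕ} (hf : 0 < L j / ∑ k ∈ range K, L k * Real.sqrt ((j : ℝ) / ((j : ℝ) + k))) :
    j ≠ 0 ∧ L j ≠ 0 := by
  constructor
  · rintro rfl
    have h0 : ∑ k ∈ range K, L k * Real.sqrt (((0 : ℕ) : ℝ) / (((0 : ℕ) : ℝ) + k)) = 0 :=
      sum_eq_zero fun k _ => by simp
    rw [h0, div_zero] at hf
    exact lt_irrefl _ hf
  · intro h0
    rw [h0, zero_div] at hf
    exact lt_irrefl _ hf

/-- **THE PROFILE SUM OF A WINDOW OF RATIO `R`.**  `L ≥ 0` with every age `k ≥ 1` carrying weight in `[K₀, R·K₀]` (`K₀ ≥ 1`, `1 ≤ R`, `log R < 16`;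
the number of ages, their sizes and the Markov weight `L_0` ARBITRARY): **`Σ_{j<K} L_j∕P_j ≤ 1∕(ρ·(1 − log R∕16))`**, `ρ = √(1∕2)`,
`P_j = Σ_{k<K} L_k·√(j∕(j+k))` — `≈ 1.61 ∕ 1.82 ∕ 1.99` at `R = 7 ∕ 36 ∕ 100` (the true suprema, attained by TWO ages at ratio `R` with weights
`1 : R^{1∕4}`, are `2∕(ρ + R^{1∕4}∕√(1+R)) ≈ 1.56 ∕ 1.80 ∕ 1.96`).  The symmetric-kernel method of `…ComparisonKernelEnergy`: Perron sandwich, line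
lemma in the coordinate `log k` on the window `[log K₀, log K₀ + log R]`, affine minorant `σ ≥ ρ(1 − |Δlog|∕8)`. [folklore] -/
theorem profileSum_le_inv_of_logWindow {K₀ : ℕ} {R : ℝ} (hL : ∀ k, 0 ≤ L k) (hK₀ : 1 ≤ K₀) (hR1 : 1 ≤ R)
    (hR : Real.log R < 16) (hwin : ∀ k, k ≠ 0 → L k ≠ 0 → K₀ ≤ k ∧ (k : ℝ) ≤ R * K₀) :
    ∑ j ∈ range K, L j / ∑ k ∈ range K, L k * Real.sqrt ((j : ℝ) / ((j : ℝ) + k))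
      ≤ 1 / (Real.sqrt (1 / 2) * (1 - Real.log R / 16)) := by
  set ρ : ℝ := Real.sqrt (1 / 2) with hρ
  have hρ0 : 0 < ρ := Real.sqrt_pos.2 (by norm_num)
  set ℓ : ℝ := Real.log R with hℓ
  have hℓ0 : 0 ≤ ℓ := Real.log_nonneg hR1
  have hK₀pos : (0 : ℝ) < K₀ := by exact_mod_cast hK₀
  have key := sum_div_le_inv_of_affine_minorant (S := range K)
    (a := fun i j : ℕ => Real.sqrt ((i : ℝ) / ((i : ℝ) + j))) (L := L)
    (P := fun j => ∑ k ∈ range K, L k * Real.sqrt ((j : ℝ) / ((j : ℝ) + k))) (w := fun j : ℕ => Real.log j)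
    (c := Real.log K₀ + ℓ / 2) (h := ℓ / 2) (ρ' := ρ) (lam := ρ / 8)
    (fun i j => Real.sqrt_nonneg _) hL (fun i => rfl) (by positivity) (by positivity) (by nlinarith) ?_ ?_
  · have e : ρ - ρ / 8 * (ℓ / 2) = ρ * (1 - ℓ / 16) := by ring
    rw [e] at key
    exact key
  · intro j _ hf
    obtain ⟨hj0, hLj⟩ := ne_zero_of_load_pos hf
    obtain ⟨h1, h2⟩ := hwin j hj0 hLj
    have hjpos : (0 : ℝ) < j := by exact_mod_cast Nat.pos_of_ne_zero hj0
    have hlo : Real.log K₀ ≤ Real.log j := Real.log_le_log hK₀pos (by exact_mod_cast h1)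
    have hhi : Real.log j ≤ ℓ + Real.log K₀ := by
      rw [hℓ, ← Real.log_mul (by positivity) hK₀pos.ne']
      exact Real.log_le_log hjpos h2
    rw [abs_le]
    constructor <;> linarith
  · intro i _ j _ hfi hfj
    obtain ⟨hi0, -⟩ := ne_zero_of_load_pos hfi
    obtain ⟨hj0, -⟩ := ne_zero_of_load_pos hfj
    have hipos : (0 : ℝ) < i := by exact_mod_cast Nat.pos_of_ne_zero hi0
    have hjpos : (0 : ℝ) < j := by exact_mod_cast Nat.pos_of_ne_zero hj0
    have hmin := sqrt_half_mul_le_geomRead hipos hjpos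
    have e : ρ - ρ / 8 * |Real.log i - Real.log j| = Real.sqrt (1 / 2) * (1 - |Real.log i - Real.log j| / 8) := by
      rw [hρ]; ring
    rw [e]
    exact hmin

/-- The numerical fact `log 100 ≤ 8·(2 − √2)` (`4.605… ≤ 4.686…`): `100 = 2⁷ ∕ (32∕25)`, `log 2 < 0.6931471808` (Mathlib), `log(32∕25) ≥ 1 − 25∕32`,
`√2 < 1.41422`. [folklore] -/
theorem log_hundred_le : Real.log 100 ≤ 8 * (2 - Real.sqrt 2) := by
  have h100 : (100 : ℝ) = 2 ^ 7 / (32 / 25) := by norm_num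
  rw [h100, Real.log_div (by norm_num) (by norm_num), Real.log_pow]
  have hl2 := Real.log_two_lt_d9
  have hl := Real.one_sub_inv_le_log_of_pos (show (0 : ℝ) < 32 / 25 by norm_num)
  have hs : Real.sqrt 2 < 1.41422 := by
    rw [Real.sqrt_lt' (by norm_num)]; norm_num
  norm_num at hl ⊢
  linarith

/-- **`Σ_j L_j∕P_j ≤ 2` FOR EVERY PROFILE WHOSE AGES LIE IN A WINDOW OF RATIO `R` WITH `log R ≤ 8(2 − √2)`** (`≈ 4.686`, `R ≤ 108.4`; any number of
ages, any sizes, any Markov weight): `1∕(ρ(1 − log R∕16)) ≤ 2` iff `log R ≤ 16(1 − ρ) = 8(2 − √2)`. [folklore] -/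
theorem profileSum_le_two_of_logWindow {K₀ : ℕ} {R : ℝ} (hL : ∀ k, 0 ≤ L k) (hK₀ : 1 ≤ K₀) (hR1 : 1 ≤ R)
    (hR : Real.log R ≤ 8 * (2 - Real.sqrt 2)) (hwin : ∀ k, k ≠ 0 → L k ≠ 0 → K₀ ≤ k ∧ (k : ℝ) ≤ R * K₀) :
    ∑ j ∈ range K, L j / ∑ k ∈ range K, L k * Real.sqrt ((j : ℝ) / ((j : ℝ) + k)) ≤ 2 := by
  set ρ : ℝ := Real.sqrt (1 / 2) with hρ
  have hρ0 : 0 < ρ := Real.sqrt_pos.2 (by norm_num)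
  have hρs : Real.sqrt 2 * ρ = 1 := by rw [hρ, ← Real.sqrt_mul (by norm_num)]; norm_num
  have hs0 : 0 < Real.sqrt 2 := by positivity
  have hR16 : Real.log R < 16 := by linarith
  have key := profileSum_le_inv_of_logWindow (K := K) hL hK₀ hR1 hR16 hwin
  refine le_trans key ?_
  have hden : 0 < ρ * (1 - Real.log R / 16) := by
    apply mul_pos hρ0; linarith
  rw [div_le_iff₀ hden]
  nlinarith [mul_le_mul_of_nonneg_left hR hρ0.le]

/-- **`Σ_j L_j∕P_j ≤ 2` FOR EVERY PROFILE WHOSE AGES `k ≥ 1` LIE IN `[K₀, 100·K₀]`** (`K₀ ≥ 1`; any number of ages, any sizes, any Markov weight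
`L_0`).  (E63e) `profileSum_le_of_window_seven`: factor `7`; (P3·T1b) `profileSum_le_two_of_three_ages_markov`: three ages within `36`. [folklore] -/
theorem profileSum_le_two_of_window_hundred {K₀ : ℕ} (hL : ∀ k, 0 ≤ L k) (hK₀ : 1 ≤ K₀)
    (hwin : ∀ k, k ≠ 0 → L k ≠ 0 → K₀ ≤ k ∧ k ≤ 100 * K₀) :
    ∑ j ∈ range K, L j / ∑ k ∈ range K, L k * Real.sqrt ((j : ℝ) / ((j : ℝ) + k)) ≤ 2 :=
  profileSum_le_two_of_logWindow hL hK₀ (by norm_num) log_hundred_le fun k hk hLk =>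
    ⟨(hwin k hk hLk).1, by exact_mod_cast (hwin k hk hLk).2⟩

/-! ## §2 The comparison theorems -/

/-- **ALL MEMORY AGES WITHIN A WINDOW OF RATIO `R`, `log R ≤ 8(2 − √2)` (`R ≤ 108.4`) ⟹ COMPARISON AT ANY SIZE** (ANY number of ages, ANY sizes, a
Markov term `L_0·u_0` riding along).  If the weights `L_k`, `k ≥ 1`, vanish outside `K₀ ≤ k ≤ R·K₀` (`K₀ ≥ 1`, `R ≥ 1`), the profile condition holds
(§1), hence every `B′ ≥ B = b + Σ_{k<K} L_k·u_k` with a zeroth moment and an ISOTONE excess has `h′ ≤ h` at every scale from every pin, by (E58b)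
`le_of_isotone_excess_affine_profile`. [folklore] -/
theorem le_of_isotone_excess_affine_logWindow {p : ℝ} {K₀ : ℕ} {R : ℝ} (hL : ∀ k, 0 ≤ L k) (hb : 0 < b) (hK₀ : 1 ≤ K₀)
    (hR1 : 1 ≤ R) (hR : Real.log R ≤ 8 * (2 - Real.sqrt 2)) (hwin : ∀ k, k ≠ 0 → L k ≠ 0 → K₀ ≤ k ∧ (k : ℝ) ≤ R * K₀)
    (hB' : ∀ u u' : ℕ → ℝ, SeqBox γ u → SeqBox γ u' → ∀ D : ℝ, (∀ j, |u j - u' j| ≤ D) → |B' u - B' u'| ≤ M' * D) (hM' : 0 ≤ M')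
    (hexc : ∀ u, SeqBox γ u → (fun u : ℕ → ℝ => b + ∑ k ∈ range K, L k * u k) u ≤ B' u)
    (hDmono : ∀ u v : ℕ → ℝ, SeqBox γ u → SeqBox γ v → (∀ j, u j ≤ v j) →
      B' u - (fun u : ℕ → ℝ => b + ∑ k ∈ range K, L k * u k) u ≤ B' v - (fun u : ℕ → ℝ => b + ∑ k ∈ range K, L k * u k) v)
    (hp : 0 < p) (hpγ : p ≤ γ) (hh : SeqBox γ h) (hf : MemFlow (fun u : ℕ → ℝ => b + ∑ k ∈ range K, L k * u k) p h)
    (hh' : SeqBox γ h') (hf' : MemFlow B' p h') (j : ℕ) : h' j ≤ h j :=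
  le_of_isotone_excess_affine_profile hL hb (profileSum_le_two_of_logWindow (K := K) hL hK₀ hR1 hR hwin)
    hB' hM' hexc hDmono hp hpγ hh hf hh' hf' j

/-- **ALL MEMORY AGES WITHIN A FACTOR 100 OF EACH OTHER ⟹ COMPARISON AT ANY SIZE** (a Markov term `L_0·u_0` may ride along; ANY number of ages,
ANY sizes).  If the weights `L_k`, `k ≥ 1`, vanish outside a window `K₀ ≤ k ≤ 100·K₀` (`K₀ ≥ 1`), every `B′ ≥ B = b + Σ_{k<K} L_k·u_k` with a zeroth
moment and an ISOTONE excess has `h′ ≤ h` at every scale from every pin.  (E58c): factor `3`; (E63e): factor `7`; (P3·T1b): three ages within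
`36`; (E64d): towers with consecutive ratios `≥ 30`. [folklore] -/
theorem le_of_isotone_excess_affine_window_hundred {p : ℝ} {K₀ : ℕ} (hL : ∀ k, 0 ≤ L k) (hb : 0 < b) (hK₀ : 1 ≤ K₀)
    (hwin : ∀ k, k ≠ 0 → L k ≠ 0 → K₀ ≤ k ∧ k ≤ 100 * K₀)
    (hB' : ∀ u u' : ℕ → ℝ, SeqBox γ u → SeqBox γ u' → ∀ D : ℝ, (∀ j, |u j - u' j| ≤ D) → |B' u - B' u'| ≤ M' * D) (hM' : 0 ≤ M')
    (hexc : ∀ u, SeqBox γ u → (fun u : ℕ → ℝ => b + ∑ k ∈ range K, L k * u k) u ≤ B' u)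
    (hDmono : ∀ u v : ℕ → ℝ, SeqBox γ u → SeqBox γ v → (∀ j, u j ≤ v j) →
      B' u - (fun u : ℕ → ℝ => b + ∑ k ∈ range K, L k * u k) u ≤ B' v - (fun u : ℕ → ℝ => b + ∑ k ∈ range K, L k * u k) v)
    (hp : 0 < p) (hpγ : p ≤ γ) (hh : SeqBox γ h) (hf : MemFlow (fun u : ℕ → ℝ => b + ∑ k ∈ range K, L k * u k) p h)
    (hh' : SeqBox γ h') (hf' : MemFlow B' p h') (j : ℕ) : h' j ≤ h j :=
  le_of_isotone_excess_affine_profile hL hb (profileSum_le_two_of_window_hundred (K := K) hL hK₀ hwin)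
    hB' hM' hexc hDmono hp hpγ hh hf hh' hf' j

end Summit.QuantumFields.BalabanUV.Beta.EriceRemainderEnclosureHistoryAutonomyComparisonWindowHundred

end
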